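import Summits.CriticalPhenomena.PercolationContinuityZ3.Theorems.PercNearOneGluingNoHeavyLowerTailCertCells
import Literature.Probability.LatticeModels.StrongHarrisKleitman
import HarnessLib

/-!
# `NoHeavyLowerTail` (stmt-CriticalPhenomena-4575) — PATTERN SUNFLOWER ROWS: Gladkov's strong Harris–Kleitman
# inequality for events read off the connection pattern of five terminals

Support file (prover prim-gen-kcluster gen 5, k-cluster line; `--supports stmt-CriticalPhenomena-4575`).  One bookkeeping
definition (`PatEvent`, the event "the connection pattern of the five terminals satisfies a Boolean test") and three
decidable side conditions (`BitSub`, `MonoPat`, `DisjPat`); no named facts, no sorries.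

WHY.  The certificate programme for the three-relay rung of the crux (ttrl `wf3lp`, cells = the 52 connection patterns of
`o, a₁, a₂, a₃, b`) proved that every "Conj-1-hard" k = 3 target of the k-cluster line — in particular `(U₁)₃` =
Kozma–Nitzan's Question 7 at `|A| = 3` — admits NO certificate over two-set-exchange (+ Harris + Reimer) rows at any
degree, by exhibiting exact pseudo-laws.  Every one of those pseudo-laws violates a STRONG HARRIS–KLEITMAN ("sunflower")
row (memo run/shared/lean/prim/prim-gen-kcluster/KCLUSTER-gen5.md §1; e.g. the Aas–Gladkov row on `(o, a₁, a₂)` by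
`1.7·10⁻²`).  This file makes that row family available on pattern cells, in the shape the certificate checker consumes:

* `PatEvent v φ` — the event that the pattern `m` of `ω` (the cell `PatternCells.Cell v m` containing `ω`) has `φ m = true`;
  `measureReal_patEvent` — its probability is the cell sum `Σ_{m consistent, φ m} μ(Cell v m)`;
* `isUpperSet_patEvent` — if `φ` is monotone under bit inclusion on the 52 consistent patterns (`MonoPat φ`, decidable)
  then `PatEvent v φ` is increasing;  `disjoint_patEvent` — pattern-disjoint tests give disjoint events;
* `patternSunflower` — **Gladkov 2024 (BLMS) Thm. 2.1 on pattern events**: for tests `φA` and `φC i` (`i ∈ s`) with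
  `MonoPat φA`, `MonoPat (φA ∨ φC i)`, `DisjPat` pairwise and against `φA`,
  `(Σ_i μ(C_i))² − Σ_i μ(C_i)² ≤ 2 μ(A) μ(B)`, `A = PatEvent v φA`, `C_i = PatEvent v (φC i)`, `B = (A ∪ ⋃ C_i)ᶜ`
  (tree: `Literature.Probability.LatticeModels.prodBernoulli_strongHarris`, PROVED);
* `patternSunflower_three` — the three-petal case written out: `c₁c₂ + c₁c₃ + c₂c₃ ≤ μ(A) μ(B)` (the Aas–Gladkov shape).
[cite: Gladkov2024StrongFKG, Thm. 2.1 and Cor. 4.2]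
-/

noncomputable section

namespace Summit.CriticalPhenomena.PercolationContinuityZ3.Theorems

open MeasureTheory Set Literature.Probability.Percolation
open Literature.Probability.LatticeModels (prodBernoulli prodBernoulli_strongHarris)
open scoped Classical BigOperators
open PatternCells CertCells

namespace PatternSunflower

variable {n : ℕ}

/-! ## Pattern events -/

/-- The event "the connection pattern of the terminals `v` passes the Boolean test `φ`". [this file] -/
def PatEvent (v : Fin 5 → Fin n) (φ : ℕ → Bool) : Set (BondConfig (Fin n)) :=
  {ω | ∃ m, m < 1024 ∧ ω ∈ Cell v m ∧ φ m = true}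

/-- Bit inclusion of the ten pair bits. [folklore] -/
def BitSub (m m' : ℕ) : Bool := (List.range 10).all fun p => !Nat.testBit m p || Nat.testBit m' p

/-- Monotonicity of a test under bit inclusion, on the consistent patterns. [folklore] -/
def MonoPat (φ : ℕ → Bool) : Bool :=
  consPatterns.all fun m => consPatterns.all fun m' => !(BitSub m m' && φ m) || φ m'

/-- Disjointness of two tests on the consistent patterns. [folklore] -/
def DisjPat (φ ψ : ℕ → Bool) : Bool := consPatterns.all fun m => !(φ m && ψ m)

/-- A configuration lies in only one cell below `1024`. [folklore] -/
theorem cell_unique (v : Fin 5 → Fin n) {m m' : ℕ} (hm : m < 1024) (hm' : m' < 1024) {ω : BondConfig (Fin n)}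
    (h : ω ∈ Cell v m) (h' : ω ∈ Cell v m') : m = m' := by
  by_contra hne
  exact Set.disjoint_left.1 (cell_disjoint v hm hm' hne) h h'

/-- Consistent patterns below `1024` are the members of `consPatterns`. [folklore] -/
theorem mem_consPatterns {m : ℕ} (hm : m < 1024) (hc : Cons5 m = true) : m ∈ consPatterns := by
  rw [consPatterns_eq, List.mem_filter, List.mem_range]
  exact ⟨hm, hc⟩

/-- Membership in a pattern event is decided by the cell. [this file] -/
theorem mem_patEvent_iff (v : Fin 5 → Fin n) (φ : ℕ → Bool) {m : ℕ} (hm : m < 1024) {ω : BondConfig (Fin n)}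
    (hω : ω ∈ Cell v m) : ω ∈ PatEvent v φ ↔ φ m = true := by
  constructor
  · rintro ⟨m', hm', hω', hφ⟩
    rw [cell_unique v hm hm' hω hω']; exact hφ
  · intro hφ; exact ⟨m, hm, hω, hφ⟩

/-- **Cell expansion of a pattern event.** [this file] -/
theorem measureReal_patEvent (μ : Measure (BondConfig (Fin n))) [IsFiniteMeasure μ] (v : Fin 5 → Fin n)
    (φ : ℕ → Bool) :
    μ.real (PatEvent v φ) =
      ∑ m ∈ (Finset.range 1024).filter (fun m => Cons5 m = true ∧ φ m = true), μ.real (Cell v m) :=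
  measureReal_eq_sum_cells μ v _ φ fun _ hm _ hω => mem_patEvent_iff v φ hm hω

/-- Opening more edges only adds pattern bits. [folklore] -/
theorem bitSub_of_subset (v : Fin 5 → Fin n) {ω ω' : BondConfig (Fin n)} (hle : ω ⊆ ω') {m m' : ℕ}
    (h : ω ∈ Cell v m) (h' : ω' ∈ Cell v m') : BitSub m m' = true := by
  unfold BitSub
  simp only [List.all_eq_true, List.mem_range, Bool.or_eq_true, Bool.not_eq_true']
  intro p hp
  by_cases hb : Nat.testBit m p = true
  · right
    have hr : (openGraph ω).Reachable (v (pairFst ⟨p, hp⟩)) (v (pairSnd ⟨p, hp⟩)) := (h ⟨p, hp⟩).2 hb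
    exact (h' ⟨p, hp⟩).1 (hr.mono (openGraph_mono hle))
  · left; simpa using hb

/-- **Monotone tests give increasing events.** [this file] -/
theorem isUpperSet_patEvent (v : Fin 5 → Fin n) {φ : ℕ → Bool} (hφ : MonoPat φ = true) :
    IsUpperSet (PatEvent v φ) := by
  intro ω ω' hle hω
  obtain ⟨m, hm, hcell, hφm⟩ := hω
  obtain ⟨m', hm', hcell'⟩ := exists_mem_cell v ω'
  refine ⟨m', hm', hcell', ?_⟩
  have hsub := bitSub_of_subset v hle hcell hcell'
  have h1 := mem_consPatterns hm (consistent_of_mem_cell v hcell)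
  have h2 := mem_consPatterns hm' (consistent_of_mem_cell v hcell')
  unfold MonoPat at hφ
  simp only [List.all_eq_true, Bool.or_eq_true, Bool.not_eq_true', Bool.and_eq_false_iff] at hφ
  rcases hφ m h1 m' h2 with (h | h) | h
  · simp [hsub] at h
  · simp [hφm] at h
  · exact h

/-- **Disjoint tests give disjoint events.** [this file] -/
theorem disjoint_patEvent (v : Fin 5 → Fin n) {φ ψ : ℕ → Bool} (h : DisjPat φ ψ = true) :
    Disjoint (PatEvent v φ) (PatEvent v ψ) := by
  rw [Set.disjoint_left]
  rintro ω ⟨m, hm, hcell, hφ⟩ ⟨m', hm', hcell', hψ⟩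
  have e := cell_unique v hm hm' hcell hcell'
  subst e
  unfold DisjPat at h
  simp only [List.all_eq_true, Bool.not_eq_true', Bool.and_eq_false_iff] at h
  rcases h m (mem_consPatterns hm (consistent_of_mem_cell v hcell)) with h1 | h1
  · simp [hφ] at h1
  · simp [hψ] at h1

/-- The union of two pattern events is the pattern event of the disjunction. [this file] -/
theorem patEvent_union (v : Fin 5 → Fin n) (φ ψ : ℕ → Bool) :
    PatEvent v φ ∪ PatEvent v ψ = PatEvent v (fun m => φ m || ψ m) := by
  ext ω
  simp only [Set.mem_union]
  constructor
  · rintro (⟨m, hm, hc, h⟩ | ⟨m, hm, hc, h⟩)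
    · exact ⟨m, hm, hc, by simp [h]⟩
    · exact ⟨m, hm, hc, by simp [h]⟩
  · rintro ⟨m, hm, hc, h⟩
    simp only [Bool.or_eq_true] at h
    rcases h with h | h
    · exact Or.inl ⟨m, hm, hc, h⟩
    · exact Or.inr ⟨m, hm, hc, h⟩

/-! ## The sunflower inequality on pattern events -/

/-- **Pattern sunflower (Gladkov's strong Harris–Kleitman inequality on pattern events).**  Let `φA` and
`φC i` (`i ∈ s`) be Boolean tests on connection patterns such that `φA` and every `φA ∨ φC i` are monotone under
bit inclusion on the consistent patterns, the `φC i` are pairwise pattern-disjoint and pattern-disjoint from `φA`.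
Then for every finite weighted graph and every placement `v` of the five terminals, with `A = PatEvent v φA`,
`C_i = PatEvent v (φC i)` and `B = (A ∪ ⋃_i C_i)ᶜ`:
`(Σ_i μ(C_i))² − Σ_i μ(C_i)² ≤ 2 · μ(A) · μ(B)`.
[cite: Gladkov2024StrongFKG, Thm. 2.1] -/
theorem patternSunflower (w : Sym2 (Fin n) → unitInterval) (v : Fin 5 → Fin n) {κ : Type*} (s : Finset κ)
    (φA : ℕ → Bool) (φC : κ → ℕ → Bool)
    (hA : MonoPat φA = true) (hAC : ∀ i ∈ s, MonoPat (fun m => φA m || φC i m) = true)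
    (hdisj : ∀ i ∈ s, ∀ j ∈ s, i ≠ j → DisjPat (φC i) (φC j) = true)
    (hdisjA : ∀ i ∈ s, DisjPat φA (φC i) = true) :
    (∑ i ∈ s, (prodBernoulli w).real (PatEvent v (φC i))) ^ 2 -
        ∑ i ∈ s, (prodBernoulli w).real (PatEvent v (φC i)) ^ 2 ≤
      2 * ((prodBernoulli w).real (PatEvent v φA) *
        (prodBernoulli w).real (PatEvent v φA ∪ ⋃ i ∈ s, PatEvent v (φC i))ᶜ) := by
  refine prodBernoulli_strongHarris w s (A := PatEvent v φA) (C := fun i => PatEvent v (φC i)) ?_ ?_ ?_ ?_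
  · intro i hi j hj hij
    exact disjoint_patEvent v (hdisj i hi j hj hij)
  · intro i hi
    exact disjoint_patEvent v (hdisjA i hi)
  · intro i hi
    rw [patEvent_union]
    exact isUpperSet_patEvent v (hAC i hi)
  · exact isUpperSet_patEvent v hA

/-- **Three petals (the Aas–Gladkov shape).**  Under the side conditions of `patternSunflower` for three tests
`φ₁, φ₂, φ₃`: `c₁c₂ + c₁c₃ + c₂c₃ ≤ μ(A)·μ(B)` with `c_i = μ(PatEvent v φ_i)`, `A = PatEvent v φA`,
`B = (A ∪ C₁ ∪ C₂ ∪ C₃)ᶜ`. [cite: Gladkov2024StrongFKG, Cor. 4.2] -/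
theorem patternSunflower_three (w : Sym2 (Fin n) → unitInterval) (v : Fin 5 → Fin n)
    (φA φ₁ φ₂ φ₃ : ℕ → Bool)
    (hA : MonoPat φA = true)
    (h1 : MonoPat (fun m => φA m || φ₁ m) = true) (h2 : MonoPat (fun m => φA m || φ₂ m) = true)
    (h3 : MonoPat (fun m => φA m || φ₃ m) = true)
    (d12 : DisjPat φ₁ φ₂ = true) (d13 : DisjPat φ₁ φ₃ = true) (d23 : DisjPat φ₂ φ₃ = true)
    (dA1 : DisjPat φA φ₁ = true) (dA2 : DisjPat φA φ₂ = true) (dA3 : DisjPat φA φ₃ = true) :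
    (prodBernoulli w).real (PatEvent v φ₁) * (prodBernoulli w).real (PatEvent v φ₂) +
        (prodBernoulli w).real (PatEvent v φ₁) * (prodBernoulli w).real (PatEvent v φ₃) +
        (prodBernoulli w).real (PatEvent v φ₂) * (prodBernoulli w).real (PatEvent v φ₃) ≤
      (prodBernoulli w).real (PatEvent v φA) *
        (prodBernoulli w).real (PatEvent v φA ∪ (PatEvent v φ₁ ∪ PatEvent v φ₂ ∪ PatEvent v φ₃))ᶜ := by
  set μ := prodBernoulli w with hμ
  let φC : Fin 3 → ℕ → Bool := ![φ₁, φ₂, φ₃]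
  have hdisjS : ∀ i ∈ (Finset.univ : Finset (Fin 3)), ∀ j ∈ (Finset.univ : Finset (Fin 3)), i ≠ j →
      DisjPat (φC i) (φC j) = true := by
    have dsym : ∀ {φ ψ : ℕ → Bool}, DisjPat φ ψ = true → DisjPat ψ φ = true := by
      intro φ ψ h
      unfold DisjPat at h ⊢
      simp only [List.all_eq_true, Bool.not_eq_true', Bool.and_eq_false_iff] at h ⊢
      intro m hm
      rcases h m hm with h' | h'
      · exact Or.inr h'
      · exact Or.inl h'
    intro i _ j _ hij
    fin_cases i <;> fin_cases j <;> first | exact absurd rfl hij | exact d12 | exact d13 | exact d23 | exact dsym d12 | exact dsym d13 | exact dsym d23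
  have hAC : ∀ i ∈ (Finset.univ : Finset (Fin 3)), MonoPat (fun m => φA m || φC i m) = true := by
    intro i _; fin_cases i
    · exact h1
    · exact h2
    · exact h3
  have hdA : ∀ i ∈ (Finset.univ : Finset (Fin 3)), DisjPat φA (φC i) = true := by
    intro i _; fin_cases i
    · exact dA1
    · exact dA2
    · exact dA3
  have H := patternSunflower w v (Finset.univ : Finset (Fin 3)) φA φC hA hAC hdisjS hdA
  have hU : (PatEvent v φA ∪ ⋃ i ∈ (Finset.univ : Finset (Fin 3)), PatEvent v (φC i)) =
      PatEvent v φA ∪ (PatEvent v φ₁ ∪ PatEvent v φ₂ ∪ PatEvent v φ₃) := by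
    ext ω
    simp only [Finset.mem_univ, Set.iUnion_true, Set.mem_union, Set.mem_iUnion]
    constructor
    · rintro (h | ⟨i, hi⟩)
      · exact Or.inl h
      · right
        fin_cases i
        · exact Or.inl (Or.inl hi)
        · exact Or.inl (Or.inr hi)
        · exact Or.inr hi
    · rintro (h | ((h | h) | h))
      · exact Or.inl h
      · exact Or.inr ⟨0, h⟩
      · exact Or.inr ⟨1, h⟩
      · exact Or.inr ⟨2, h⟩
  rw [hU] at H
  simp only [Fin.sum_univ_three] at H
  have e0 : φC 0 = φ₁ := rfl
  have e1 : φC 1 = φ₂ := rfl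
  have e2 : φC 2 = φ₃ := rfl
  rw [e0, e1, e2] at H
  nlinarith [H]

/-! ## A worked instance: the Aas–Gladkov row on the terminals `0, 1, 2` -/

/-- **The Aas–Gladkov row on pattern events of the terminals `0, 1, 2`** (pair bits `0 = (0,1)`, `1 = (0,2)`,
`4 = (1,2)`; all side conditions by `decide`): with `A = {0~1, 0~2}`, `C₁ = {0~1, 0≁2}`, `C₂ = {0~2, 0≁1}`,
`C₃ = {1~2, 0≁1}` and `B` the complement,  `μ(C₁)μ(C₂) + μ(C₁)μ(C₃) + μ(C₂)μ(C₃) ≤ μ(A)·μ(B)` — the row that every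
pseudo-law of the `(U₁)₃` certificate search violates (KCLUSTER-gen5.md §1). [cite: Gladkov2024StrongFKG, Cor. 4.2] -/
theorem aasGladkov_pattern012 (w : Sym2 (Fin n) → unitInterval) (v : Fin 5 → Fin n) :
    (prodBernoulli w).real (PatEvent v fun m => Nat.testBit m 0 && !Nat.testBit m 1) *
          (prodBernoulli w).real (PatEvent v fun m => Nat.testBit m 1 && !Nat.testBit m 0) +
        (prodBernoulli w).real (PatEvent v fun m => Nat.testBit m 0 && !Nat.testBit m 1) *
          (prodBernoulli w).real (PatEvent v fun m => Nat.testBit m 4 && !Nat.testBit m 0) +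
        (prodBernoulli w).real (PatEvent v fun m => Nat.testBit m 1 && !Nat.testBit m 0) *
          (prodBernoulli w).real (PatEvent v fun m => Nat.testBit m 4 && !Nat.testBit m 0) ≤
      (prodBernoulli w).real (PatEvent v fun m => Nat.testBit m 0 && Nat.testBit m 1) *
        (prodBernoulli w).real
          (PatEvent v (fun m => Nat.testBit m 0 && Nat.testBit m 1) ∪
            (PatEvent v (fun m => Nat.testBit m 0 && !Nat.testBit m 1) ∪
              PatEvent v (fun m => Nat.testBit m 1 && !Nat.testBit m 0) ∪
              PatEvent v (fun m => Nat.testBit m 4 && !Nat.testBit m 0)))ᶜ :=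
  patternSunflower_three w v _ _ _ _ (by decide) (by decide) (by decide) (by decide) (by decide)
    (by decide) (by decide) (by decide) (by decide) (by decide)

end PatternSunflower

end Summit.CriticalPhenomena.PercolationContinuityZ3.Theorems

end
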